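import Summits.BirchSwinnertonDyer.BirchSwinnertonDyer.Theses.PrintCf2
import Summits.BirchSwinnertonDyer.BirchSwinnertonDyer.Theorems.PrintCf2SplitBadTwoHalvesOfHeegnerIndexAtTwoByName
import HarnessLib

/-!
# Child crux `PrintCf2.SplitBadTwoUpperHalfOfFacts` (item stmt-BirchSwinnertonDyer-27850) — skeleton line `heegner_index_two` (UPPER) = children v3

Cell `bsd-print-cf2`, LEAD `bsd-line-cf2-p1` g8 (crux stmt-BirchSwinnertonDyer-20368; this child is one of its two halves, glue 27852 closed), after
planner g16's RULING (x) «INDEX CURRENCY ADOPTED; ONE WRITER: the LEAD registers v3» and its typing checklist (PLAN §5 v1.28: facts antecedent ⊇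
GZ + Kolyvagin via `ToricPublishedInputs`; frames display `d_K < −4`, the Heegner hypothesis, `r_an(E_K) = 1`; Manin term exactly as the bridge
states it; 2 stubs, composition BY NAME, sorries = stubs). Supersedes `kside_finite_two` v2 (8565dbaac870380e) as the skeleton of record; v2's stub
`stub_kolyvaginUpperOverKAtTwo` stays registered (cumulative registry) and stays CLOSABLE from this line's research stub via the landed bridges
(LEAD g8 p638495 §1 + -w4 g3 p638826 / -w3 g2 p638806 for the upper half).

TWO registered stubs:
* `stub_prints_kside_two` [cite-level, TWO named facts: `ToricPublishedInputs` (item 20389) ∧ Milne 1972 §1 Thm 1 any-model (item 24149)] —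
  unchanged from `kside_finite_two` (same name, same signature);
* `stub_heegnerIndexUpperAtTwo` [RESEARCH = the whole difficulty, FACTS-RELATIVE, Gross–Zagier-free conclusion: Kolyvagin's `2`-adic bound over `K` in INDEX currency on every Heegner frame — `ord₂ #Ш(E/K)[2^∞] + ord₂ c_K ≤ 2·ord₂ [E(K):ℤP] − 2·ord₂ c`; CM class with rational `2`-torsion, `E` additive at `2`; no print].
Composition `SplitBadTwoUpperHalfOfFacts_of` concludes the child crux BY NAME through LEAD g8's
`EisensteinTwo.splitBadTwoUpperHalfOfFacts_of_heegnerIndexStub` (`Theorems/PrintCf2SplitBadTwoHalvesOfHeegnerIndexAtTwoByName.lean`);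
the only `sorry`s are the two stubs.
-/

set_option autoImplicit false
set_option linter.dupNamespace false

noncomputable section

open scoped Classical NumberField

namespace Summit.BirchSwinnertonDyer.BirchSwinnertonDyer.Cruxes.SplitBadTwoUpperHalfOfFacts.HeegnerIndexTwo

open WeierstrassCurve NumberField Literature.NumberTheory.EllipticCurves Literature.NumberTheory.EllipticCurves.ModularForms
  Literature.NumberTheory.EllipticCurves.Rank1Residual Literature.NumberTheory.EllipticCurves.Rank1Residual.Typed
  Summit.BirchSwinnertonDyer.Rank1Residual Summit.BirchSwinnertonDyer.Rank1Residual.AdditivePotMult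
  Summit.BirchSwinnertonDyer.BirchSwinnertonDyer.Theses.UniversalToricDescent
  Summit.BirchSwinnertonDyer.BirchSwinnertonDyer.Theorems

/-- **Stub P (cite-level, TWO named facts).** The toric published inputs (Gross–Zagier, Kolyvagin, GZK, modularity, Friedberg–Hoffstein,
parity, Heegner points; item 20389 `ToricPublishedInputs`) and Milne 1972 §1 Thm 1 in the any-model form (item 24149). Not a prover task:
closes by booking an `…OfFactsPlus` twin or by the items. [cite: Milne1972ArithmeticAV, §1 Thm. 1 (p. 182)] [cite: FriedbergHoffstein1995, Thm. B] -/
theorem stub_prints_kside_two :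
    (ToricPublishedInputs ∧ Milne1972.bsdQuotient_baseChange_quadratic_anyModel) := by
  sorry

/-- **Stub U″ (RESEARCH — Kolyvagin's half at `2`, finite level, INDEX currency; facts-relative; Gross–Zagier-free conclusion).** RELATIVE TO the
line's prints (`ToricPublishedInputs` ∧ Milne any-model) and the child crux's bundle 𝔅_split: for every `W` in the split-bad CM rank-one class
(`K₀ = ℚ(√−7)`, `j ∈ {−3375, 16581375}`, additive at `2`) and every Heegner frame `(N, K, Dt, H, ι, P)` of `W` — `N = N_W`, `K` imaginary
quadratic with the Heegner hypothesis for `N`, `d_K < −4`, `L(E^{(d_K)},1) ≠ 0`, `r_an(E_K) = 1`, `P ∈ E(K)` the Heegner point of the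
parametrisation `Dt` (Manin constant `c = Dt.c`) and the Heegner datum `H`, `P` non-torsion, `rank E(K) = 1`, `Ш(E/K)` finite (all DISPLAYED;
the prints give them) —: `ord₂ #Ш(E/K)[2^∞] + ord₂ c_K ≤ 2·ord₂ [E(K):ℤP] − 2·ord₂ c`, the `2`-part of Kolyvagin's bound
`#Ш · c_K ∣ (I/c)²` (`c_K` = Tamagawa product of `E/K`). Research content: Kolyvagin's method at `p = 2` for a CM curve with rational
`2`-torsion (`ρ̄_{E,2}^{ss} = 𝟙 ⊕ 𝟙`), `E` additive at `2`; Kolyvagin 1990 Thm. A carries an unspecified `2`-power, CGLS 2022 Thm. 3.2.1 and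
Jetchev 2008 take `p` odd. Equivalent (given the prints) to v2's `stub_kolyvaginUpperOverKAtTwo` (bridges p638495 §1, p638826, p638806).
[cite: Kolyvagin1990, Thm. A] [cite: Gross1991, Thm. 1.3 and §3] [cite: CastellaGrossiLeeSkinner2022, Thm. 3.2.1 (p odd)] -/
theorem stub_heegnerIndexUpperAtTwo :
    (ToricPublishedInputs ∧ Milne1972.bsdQuotient_baseChange_quadratic_anyModel) →
      (Literature.NumberTheory.EllipticCurves.rank_eq_analyticRank_of_analyticRank_le_one ∧ WeierstrassCurve.hasEntireLFunction_rat ∧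
        WeierstrassCurve.bsdRHS_eq_of_isIsogenous ∧ Literature.NumberTheory.EllipticCurves.bsdTriple_of_hasCM_of_L_one_ne_zero ∧
        Literature.NumberTheory.EllipticCurves.KrizLi2019.thm112_bsdTwo_twist) →
    ∀ (W : WeierstrassCurve ℚ) [W.IsElliptic] [W.IsGloballyMinimal], W.HasCM → W.analyticRank = 1 → CMSplit W 2 → ¬ Good W 2 →
      ∀ (N : ℕ) [NeZero N] (K : Type) [Field K] [NumberField K] (Dt : ModularParametrizationData W N)
        (H : HeegnerDatum N (NumberField.discr K)) (ι : K →+* ℂ) (P : (W.baseChange K).toAffine.Point),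
        W.conductorNorm ℤ = N → IsImaginaryQuadratic K → SatisfiesHeegnerHypothesis N K → NumberField.discr K < -4 →
        (W.quadraticTwist (NumberField.discr K : ℚ)).entireLFunction 1 ≠ 0 → (W.baseChange K).analyticRank = 1 →
        WeierstrassCurve.Affine.Point.map ι.toRatAlgHom P = heegnerPointComplex Dt H → ¬ IsOfFinAddOrder P →
        (W.baseChange K).mordellWeilRank = 1 → Finite (W.baseChange K).sha →
        (padicValNat 2 (Nat.card (AddCommGroup.primaryComponent (W.baseChange K).sha 2)) : ℤ) +
            (padicValNat 2 (W.baseChange K).tamagawaProduct : ℤ) ≤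
          2 * (padicValNat 2 (AddSubgroup.zmultiples P).index : ℤ) - 2 * (padicValNat 2 Dt.c.natAbs : ℤ) := by
  sorry

/-- **The child crux from the two stubs** (composition BY NAME; the only `sorry`s are inside `stub_*`). -/
theorem SplitBadTwoUpperHalfOfFacts_of :
    Summit.BirchSwinnertonDyer.BirchSwinnertonDyer.Theses.PrintCf2.SplitBadTwoUpperHalfOfFacts :=
  PrintCf2.EisensteinTwo.splitBadTwoUpperHalfOfFacts_of_heegnerIndexStub stub_prints_kside_two stub_heegnerIndexUpperAtTwo

end Summit.BirchSwinnertonDyer.BirchSwinnertonDyer.Cruxes.SplitBadTwoUpperHalfOfFacts.HeegnerIndexTwo
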